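import Mathlib
import Summits.Ventures.HodgeRepro2.T5GaussianField
import Summits.Ventures.HodgeRepro2.T6N5LocalSignModelGlobalWitness
import Summits.Ventures.HodgeRepro2.T6N5LocalSignModelCM

/-!
# T6N5LocalSignModelCMWitness — Tier 6, M2 sub-step N5 (t6-p8's half): THE §10.5(ii)(c),(d) WITNESS of
`T6N5LocalSignModelCM` — the CM-form statement `exists_signModel_ofCM` instantiated UNIFORMLY on every CM field with
the gen-6 toy data, and at the concrete CM field `ℚ(ζ₄)`

* `toyFamilyCM E` / `toyFamilyCM_hyps` — the toy three data (`T6N5LocalSignModelGlobalWitness.toyThreeData`: toy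
  parameter, toy `ψ_δ`, toy Weil carrier — uniform in the place data) at every non-split finite place of `E⁺` in `E`,
  with the per-place `Hyps`, for ANY CM field `E`;
* `cm_global_witness E` — every hypothesis of `exists_signModel_ofCM` discharged on any CM field `E` (t6-p7's
  `Toy.toy` on both sides at every real place of `E⁺`): a sign model on `GlobalIndex E⁺` with `Solves ∧ RealCondB`;
* `isCMField_L` — `ℚ(ζ₄)` is a CM field (Mathlib's `IsCyclotomicExtension.Rat.isCMField` on p4's `isCyclotomic`, `2 < 4`): the carrier
  `[IsCMField E]` of the CM form is instantiable (README §10.5(ii)(c)); `gaussian_cm_witness` — the CM-form witness at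
  `ℚ(ζ₄)` (README §10.5(ii)(d)).

READING: what separates these witnesses from the host is exactly the three data per non-split finite place (toys
modelling the ε-factor parameter and the Weil carrier vs the genuine objects with their displays) and the real data
(t6-p7's toys vs the genuine ones); nothing here transfers a toy to the host datum (the ledger's l. 383 caveat).
NOT SHOWN here: that `kindOf E⁺ E` takes the value `ns` at some finite place of `E⁺` for the CM form (for the
`ofGlobal` form on `ℚ ⊆ ℚ(ζ₄)` this is `T6N5LocalSignModelGlobalWitness.kindOf_v₂`; for `E⁺ = maximalRealSubfield E`
it needs the identification of `maximalRealSubfield ℚ(ζ₄)` with `ℚ` and a transport of p4's place data — left open).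
Definition lane; no display. Filed in WAVE 1 (p438084, 2026-08-26). §8(d): uses an L-value-free non-vanishing device: NO.
-/

namespace Summit.Ventures.HodgeRepro2.T6.N5LocalSignModelCMWitness

open Summit.Ventures.HodgeRepro2 IsDedekindDomain HeightOneSpectrum NumberField
  Summit.Ventures.HodgeRepro2.T6.N5Rich Summit.Ventures.HodgeRepro2.T6.N5RealPlace
  Summit.Ventures.HodgeRepro2.T6.N5LocalSignModel Summit.Ventures.HodgeRepro2.T6.N5LocalSignModelGlobal
  Summit.Ventures.HodgeRepro2.T6.N5LocalSignModelGlobalWitness Summit.Ventures.HodgeRepro2.T6.N5LocalSignModelCM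

noncomputable section

/-! ### The toy family and the witness on ANY CM field -/

section AnyCM

variable (E : Type) [Field E] [NumberField E] [IsCMField E]

/-- THE TOY THREE DATA AT EVERY NON-SPLIT FINITE PLACE of `E⁺` in `E`, for any CM field `E`. -/
def toyFamilyCM : ThreeDataFamily (maximalRealSubfield E) E :=
  fun v h => toyThreeData v (placeAbove h)
    (placeData v (placeAbove h) (finrank_maximalRealSubfield_eq_two E) (placeAbove_unique h))

/-- The per-place hypotheses hold on the toy family at every non-split finite place of `E⁺`. -/
theorem toyFamilyCM_hyps (v : HeightOneSpectrum (RingOfIntegers (maximalRealSubfield E)))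
    (h : IsNonSplit (maximalRealSubfield E) E v) :
    (localInputAt (finrank_maximalRealSubfield_eq_two E) (toyFamilyCM E) h).Hyps :=
  ofUnique_toyThreeData_hyps v (placeAbove h) (finrank_maximalRealSubfield_eq_two E) (placeAbove_unique h)

/-- THE WITNESS, UNIFORM IN THE CM FIELD: on the places of `E⁺` (finite ⊕ real) there is a sign model with the
global kinds relative to `E`, the statements of record's local data with the toy three data at every non-split
finite place, t6-p7's toy real data on both sides at every real place, and `Solves ∧ RealCondB` — every hypothesis
of `exists_signModel_ofCM` discharged. -/
theorem cm_global_witness :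
    ∃ S : SignModel (GlobalIndex (maximalRealSubfield E)), S.kind = kindOf (maximalRealSubfield E) E ∧
      S.D = (PlaceFamily.ofCM E (toyFamilyCM E)).D ∧ S.Solves ∧ S.RealCondB :=
  exists_signModel_ofCM E (toyFamilyCM E) (toyFamilyCM_hyps E) (fun _ => Toy.toy) (fun _ => Toy.toy)
    (fun _ => Toy.toy_thm3_5) (fun _ => Toy.toy_thm3_5) (fun _ => Toy.toy_fockDict) (fun _ => Toy.toy_fockDict)
    (fun _ => Toy.toy_halfLine) (fun _ => Toy.toy_halfLine)

end AnyCM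

/-! ### The concrete CM field `ℚ(ζ₄)` -/

section Gaussian

open T5GaussianField

/-- `ℚ(ζ₄)` IS A CM FIELD (Mathlib's `IsCyclotomicExtension.Rat.isCMField` on `{4}`, `2 < 4`): the carrier
`[IsCMField E]` of the CM-form statement is instantiable. -/
theorem isCMField_L : IsCMField L :=
  letI := isCyclotomic
  IsCyclotomicExtension.Rat.isCMField L (S := {4}) ⟨4, rfl, by norm_num⟩

/-- The CM-form witness at the concrete CM field `ℚ(ζ₄)`: `cm_global_witness` with `isCMField_L`. -/
theorem gaussian_cm_witness :
    letI := isCMField_L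
    ∃ S : SignModel (GlobalIndex (maximalRealSubfield L)), S.kind = kindOf (maximalRealSubfield L) L ∧
      S.D = (PlaceFamily.ofCM L (toyFamilyCM L)).D ∧ S.Solves ∧ S.RealCondB :=
  letI := isCMField_L
  cm_global_witness L

end Gaussian

end

end Summit.Ventures.HodgeRepro2.T6.N5LocalSignModelCMWitness
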